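import Summits.HodgeConjecture.HodgeConjecture.Theorems.Ring2AtlasCMSixfolds
import Literature.AlgebraicGeometry.HodgeTheory.HodgeClassesIsogenyInvariance
import Literature.AlgebraicGeometry.HodgeTheory.AbelianVarietyHOneExactness
import Literature.AlgebraicGeometry.HodgeTheory.HodgeTypeExteriorProduct
import Literature.AlgebraicGeometry.Motives.AimedSplitProductProofs
import Literature.AlgebraicGeometry.Motives.AbelianVarietySimpleFactorsUnique
import HarnessLib

/-!
# `HasBalancedQuadraticEndomorphism` is an isogeny invariant (multiplicities `n_σ` along isogenies)

Cell `pub-hodgecm2` (COR-CM), count-neutral literature seat `lit-deligne-3` gen 5; KERNEL ONLY (theorems; no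
definition, no named fact).  Part of the closing of the ring-2 atlas cell `HodgeNondegenerateCMSixfold`
(`CMSixfoldRank/SimpleCMSixfoldNondegenerateHodge.lean`).

For an isogeny `f : X → Y` with quasi-inverse `g : Y → X` (`f ≫ g = [n]_X`, `g ≫ f = [n]_Y`, `n ≥ 1`, Mumford §19)
and an endomorphism `φ` of `Y`, the endomorphism `ψ = f ≫ φ ≫ g` ("`g φ f`") of `X` has
`ψ ≫ ψ = n • f ≫ φ² ≫ g`, and on `H¹`: `ψ^* = f^* φ^* g^*` with `g^* f^* = n`, `f^* g^* = n`; so `f^*` carries the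
`ρ`-eigenspace of `φ^*` in `H^{1,0}(Y)` injectively into the `nρ`-eigenspace of `ψ^*` in `H^{1,0}(X)` and `g^*`
carries it back: the multiplicities agree, `eigenMultiplicity X ψ (nρ) = eigenMultiplicity Y φ ρ`
(`eigenMultiplicity_conj_eq`).  Consequently `φ ≫ φ = -d`, `n_{i√d}(φ) = 3` on `Y` gives `ψ ≫ ψ = -(d n²)`,
`n_{i√(dn²)}(ψ) = 3` on `X`: `HasBalancedQuadraticEndomorphism` (`Ring2AtlasCMSixfolds`) descends along
isogenies in both directions (`hasBalancedQuadraticEndomorphism_of_isIsogenous`, `…_iff_of_isIsogenous`) — the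
multiplicities `n_σ` of Moonen–Zarhin are isogeny invariants ("the action of `k` on `Lie(X)`… depends only on the
isogeny class").

## References

* [MumfordAV1970] D. Mumford, *Abelian varieties* (1970), §19 (quasi-inverse of an isogeny, Remark p. 169; the
  representation on `H¹`).
* [MoonenZarhin1998WeilClasses] B. Moonen, Yu. Zarhin, *Weil classes on abelian varieties*, J. reine angew. Math.
  496 (1998), §1 (the multiplicities `n_σ`).
* [LangeBirkenhake1992] H. Lange, Ch. Birkenhake, *Complex abelian varieties*, §1.2 (analytic and rational
  representations; isogenies induce isomorphisms on `H¹(−, ℚ)`).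
-/

noncomputable section

open CategoryTheory

namespace Summit.HodgeConjecture.CorCM.CMSixfoldRank

open Literature.AlgebraicGeometry Literature.AlgebraicGeometry.Motives
open Literature.AlgebraicGeometry.Motives.AbelianVariety
open Literature.AlgebraicGeometry.HodgeTheory
open Literature.AlgebraicTopology.SingularHomology
open Summit.HodgeConjecture.HodgeConjecture.Ring2.Atlas

variable {X Y : AbelianVariety ℂ}

/-- `(f ≫ φ ≫ g)^* = f^* ∘ φ^* ∘ g^*` on `H¹`, applied form. [cite: LangeBirkenhake1992, §1.2] -/
theorem complexBetti_map_conj_apply (f : X ⟶ Y) (φ : Y ⟶ Y) (g : Y ⟶ X) (w : complexBetti X.X 1) :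
    (complexBetti.map (f ≫ φ ≫ g).hom.hom.hom 1).hom w =
      (complexBetti.map f.hom.hom.hom 1).hom
        ((complexBetti.map φ.hom.hom.hom 1).hom ((complexBetti.map g.hom.hom.hom 1).hom w)) := by
  change complexBetti.map (f ≫ φ ≫ g).hom.hom.hom 1 w =
    complexBetti.map f.hom.hom.hom 1 (complexBetti.map φ.hom.hom.hom 1 (complexBetti.map g.hom.hom.hom 1 w))
  rw [complexBetti_map_map_hom, complexBetti_map_map_hom, Category.assoc]

/-- **`f^*` maps `ker(φ^* − ρ) ∩ H^{1,0}(Y)` into `ker(ψ^* − nρ) ∩ H^{1,0}(X)`**, `ψ = f ≫ φ ≫ g`, `g ≫ f = [n]`.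
[cite: MumfordAV1970, §19 Remark p. 169] [cite: MoonenZarhin1998WeilClasses, §1 (the multiplicities n_σ)] -/
theorem map_mem_eigenspace_inf_hodgeOneZero {f : X ⟶ Y} {g : Y ⟶ X} {n : ℕ} (hgf : g ≫ f = n • 𝟙 Y)
    (φ : Y ⟶ Y) (ρ : ℂ) {v : complexBetti Y.X 1}
    (hv : v ∈ Module.End.eigenspace (complexBetti.map φ.hom.hom.hom 1).hom ρ ⊓
      hodgeOneZero (AbelianVariety.isSmoothProjective_holds (A := Y))) :
    (complexBetti.map f.hom.hom.hom 1).hom v ∈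
      Module.End.eigenspace (complexBetti.map (f ≫ φ ≫ g).hom.hom.hom 1).hom ((n : ℂ) * ρ) ⊓
        hodgeOneZero (AbelianVariety.isSmoothProjective_holds (A := X)) := by
  have hv1 : (complexBetti.map φ.hom.hom.hom 1).hom v = ρ • v := Module.End.mem_eigenspace_iff.1 hv.1
  have hgfv : (complexBetti.map g.hom.hom.hom 1).hom ((complexBetti.map f.hom.hom.hom 1).hom v) = (n : ℂ) • v :=
    complexBetti_map_map_one_of_comp_eq_nsmul_id hgf v
  refine ⟨Module.End.mem_eigenspace_iff.2 ?_, ?_⟩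
  · rw [complexBetti_map_conj_apply, hgfv, map_smul, hv1, map_smul, map_smul, smul_smul]
  · exact (mem_hodgeOneZero _).2 (((mem_hodgeOneZero _).1 hv.2).map_of_isSmoothProjective
      (AbelianVariety.isSmoothProjective_holds (A := X)) (AbelianVariety.isSmoothProjective_holds (A := Y))
      f.hom.hom.hom)

/-- **`g^*` maps `ker(ψ^* − nρ) ∩ H^{1,0}(X)` back into `ker(φ^* − ρ) ∩ H^{1,0}(Y)`** (`n ≥ 1`): from
`f^* φ^* g^* w = nρ·w` apply `g^*` and use `g^* f^* = n`. [cite: MumfordAV1970, §19 Remark p. 169]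
[cite: MoonenZarhin1998WeilClasses, §1 (the multiplicities n_σ)] -/
theorem map_mem_eigenspace_inf_hodgeOneZero_symm {f : X ⟶ Y} {g : Y ⟶ X} {n : ℕ} (hn : 0 < n)
    (hgf : g ≫ f = n • 𝟙 Y) (φ : Y ⟶ Y) (ρ : ℂ) {w : complexBetti X.X 1}
    (hw : w ∈ Module.End.eigenspace (complexBetti.map (f ≫ φ ≫ g).hom.hom.hom 1).hom ((n : ℂ) * ρ) ⊓
      hodgeOneZero (AbelianVariety.isSmoothProjective_holds (A := X))) :
    (complexBetti.map g.hom.hom.hom 1).hom w ∈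
      Module.End.eigenspace (complexBetti.map φ.hom.hom.hom 1).hom ρ ⊓
        hodgeOneZero (AbelianVariety.isSmoothProjective_holds (A := Y)) := by
  have hw1 : (complexBetti.map (f ≫ φ ≫ g).hom.hom.hom 1).hom w = ((n : ℂ) * ρ) • w :=
    Module.End.mem_eigenspace_iff.1 hw.1
  rw [complexBetti_map_conj_apply] at hw1
  have h2 := congrArg (complexBetti.map g.hom.hom.hom 1).hom hw1
  have hgf' : (complexBetti.map g.hom.hom.hom 1).hom ((complexBetti.map f.hom.hom.hom 1).hom
      ((complexBetti.map φ.hom.hom.hom 1).hom ((complexBetti.map g.hom.hom.hom 1).hom w))) =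
      (n : ℂ) • (complexBetti.map φ.hom.hom.hom 1).hom ((complexBetti.map g.hom.hom.hom 1).hom w) :=
    complexBetti_map_map_one_of_comp_eq_nsmul_id hgf _
  rw [hgf', map_smul, ← smul_smul] at h2
  have hn0 : (n : ℂ) ≠ 0 := Nat.cast_ne_zero.2 hn.ne'
  refine ⟨Module.End.mem_eigenspace_iff.2 (smul_right_injective _ hn0 h2), ?_⟩
  exact (mem_hodgeOneZero _).2 (((mem_hodgeOneZero _).1 hw.2).map_of_isSmoothProjective
    (AbelianVariety.isSmoothProjective_holds (A := Y)) (AbelianVariety.isSmoothProjective_holds (A := X))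
    g.hom.hom.hom)

/-- **The multiplicities `n_σ` along an isogeny**: for `f ≫ g = [n]_X`, `g ≫ f = [n]_Y` (`n ≥ 1`) and `φ ∈ End(Y)`,
`eigenMultiplicity X (f ≫ φ ≫ g) (nρ) = eigenMultiplicity Y φ ρ` (`f^*`, `g^*` are injective on `H¹` and exchange
the two spaces). [cite: MumfordAV1970, §19 Remark p. 169] [cite: MoonenZarhin1998WeilClasses, §1 (the multiplicities n_σ)] -/
theorem eigenMultiplicity_conj_eq {f : X ⟶ Y} {g : Y ⟶ X} {n : ℕ} (hn : 0 < n) (hfg : f ≫ g = n • 𝟙 X)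
    (hgf : g ≫ f = n • 𝟙 Y) (φ : Y ⟶ Y) (ρ : ℂ) :
    eigenMultiplicity X (f ≫ φ ≫ g) ((n : ℂ) * ρ) = eigenMultiplicity Y φ ρ := by
  haveI := finite_complexBetti_abelianVariety X 1
  haveI := finite_complexBetti_abelianVariety Y 1
  unfold eigenMultiplicity
  set EX := Module.End.eigenspace (complexBetti.map (f ≫ φ ≫ g).hom.hom.hom 1).hom ((n : ℂ) * ρ) ⊓
    hodgeOneZero (AbelianVariety.isSmoothProjective_holds (A := X))
  set EY := Module.End.eigenspace (complexBetti.map φ.hom.hom.hom 1).hom ρ ⊓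
    hodgeOneZero (AbelianVariety.isSmoothProjective_holds (A := Y))
  have hfinj : Function.Injective (complexBetti.map f.hom.hom.hom 1) :=
    complexBetti_map_injective_of_comp_eq_nsmul_id hn.ne' hgf 1
  have hginj : Function.Injective (complexBetti.map g.hom.hom.hom 1) :=
    complexBetti_map_injective_of_comp_eq_nsmul_id hn.ne' hfg 1
  refine le_antisymm ?_ ?_
  · let G : ↥EX →ₗ[ℂ] ↥EY :=
      LinearMap.codRestrict _ ((complexBetti.map g.hom.hom.hom 1).hom.domRestrict _)
        (fun w ↦ map_mem_eigenspace_inf_hodgeOneZero_symm hn hgf φ ρ w.2)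
    refine LinearMap.finrank_le_finrank_of_injective (f := G) fun v w hvw ↦ ?_
    apply Subtype.ext
    exact hginj (congrArg Subtype.val hvw)
  · let F : ↥EY →ₗ[ℂ] ↥EX :=
      LinearMap.codRestrict _ ((complexBetti.map f.hom.hom.hom 1).hom.domRestrict _)
        (fun v ↦ map_mem_eigenspace_inf_hodgeOneZero hgf φ ρ v.2)
    refine LinearMap.finrank_le_finrank_of_injective (f := F) fun v w hvw ↦ ?_
    apply Subtype.ext
    exact hfinj (congrArg Subtype.val hvw)

/-- `(f ≫ φ ≫ g)² = -(d n²)` when `φ² = -d`, `g ≫ f = [n]`, `f ≫ g = [n]` (computation in the preadditive category of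
abelian varieties). [cite: MumfordAV1970, §19 Remark p. 169] -/
theorem conj_comp_conj_eq {f : X ⟶ Y} {g : Y ⟶ X} {n d : ℕ} (hfg : f ≫ g = n • 𝟙 X) (hgf : g ≫ f = n • 𝟙 Y)
    {φ : Y ⟶ Y} (hφ : φ ≫ φ = -(d • 𝟙 Y)) :
    (f ≫ φ ≫ g) ≫ (f ≫ φ ≫ g) = -((d * n ^ 2) • 𝟙 X) := by
  have h1 : (f ≫ φ ≫ g) ≫ (f ≫ φ ≫ g) = f ≫ φ ≫ (g ≫ f) ≫ φ ≫ g := by simp only [Category.assoc]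
  rw [h1, hgf, Preadditive.nsmul_comp, Category.id_comp, Preadditive.comp_nsmul, Preadditive.comp_nsmul,
    ← Category.assoc φ φ g, hφ, Preadditive.neg_comp, Preadditive.nsmul_comp, Category.id_comp,
    Preadditive.comp_neg, Preadditive.comp_nsmul, hfg, smul_neg, smul_smul, smul_smul]
  congr 2
  ring

/-- `√(d n²) = n √d` in `ℂ` (`d, n ∈ ℕ`). [folklore] -/
theorem sqrt_mul_sq_cast (d n : ℕ) :
    ((Real.sqrt ((d * n ^ 2 : ℕ) : ℝ) : ℝ) : ℂ) = (n : ℂ) * (Real.sqrt d : ℂ) := by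
  have h : Real.sqrt ((d * n ^ 2 : ℕ) : ℝ) = (n : ℝ) * Real.sqrt d := by
    rw [Nat.cast_mul, Nat.cast_pow, Real.sqrt_mul' _ (sq_nonneg _), Real.sqrt_sq (Nat.cast_nonneg n), mul_comm]
  rw [h]
  push_cast
  ring

/-- **`HasBalancedQuadraticEndomorphism` descends along isogenies `X → Y`**: if `Y` has `φ` with `φ² = -d`
(`d ≥ 1`) and `n_{i√d}(φ) = 3`, then `X ∼ Y` has `ψ = f ≫ φ ≫ g` with `ψ² = -(d n²)` and `n_{i√(dn²)}(ψ) = 3`.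
[cite: MoonenZarhin1998WeilClasses, §1 (the multiplicities n_σ)] [cite: MumfordAV1970, §19 Remark p. 169] -/
theorem hasBalancedQuadraticEndomorphism_of_isIsogenous (h : IsIsogenous X Y)
    (hY : HasBalancedQuadraticEndomorphism Y) : HasBalancedQuadraticEndomorphism X := by
  obtain ⟨f, hf⟩ := h
  obtain ⟨g, n, hn, hfg, hgf⟩ := AbelianVariety.IsIsogeny.exists_nsmul_inverse_holds hf
  obtain ⟨φ, d, hd, hφ, hmult⟩ := hY
  refine ⟨f ≫ φ ≫ g, d * n ^ 2, Nat.mul_pos hd (pow_pos hn 2), conj_comp_conj_eq hfg hgf hφ, ?_⟩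
  rw [sqrt_mul_sq_cast, ← mul_assoc, mul_comm Complex.I (n : ℂ), mul_assoc,
    eigenMultiplicity_conj_eq hn hfg hgf φ _, hmult]

/-- … and ascends (isogeny is symmetric). [cite: MoonenZarhin1998WeilClasses, §1 (the multiplicities n_σ)]
[cite: MumfordAV1970, §19 (remark before Thm. 1, p. 169)] -/
theorem hasBalancedQuadraticEndomorphism_iff_of_isIsogenous (h : IsIsogenous X Y) :
    HasBalancedQuadraticEndomorphism X ↔ HasBalancedQuadraticEndomorphism Y :=
  ⟨hasBalancedQuadraticEndomorphism_of_isIsogenous (IsIsogenous.symm' h),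
    hasBalancedQuadraticEndomorphism_of_isIsogenous h⟩

end Summit.HodgeConjecture.CorCM.CMSixfoldRank

end
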